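import Literature.AlgebraicGeometry.Resolution.BlowupSNC
import Mathlib.RingTheory.Filtration
import HarnessLib

/-!
# [OURS · L1 W4.5(b) · EL♮(3) · T23-A′ (A′-3), LOCAL HALF] The regular system of parameters `(exceptional, strict transform of the member,
# uniformiser)` at a point of the blow-up over a TRANSVERSAL crossing point

Crux EL♮(3) = stmt-ResolutionOfSingularities-20148 (child of EL♮ stmt-…-20038; bookkeeping crux `EquisingularLift` stmt-…-15660); T23-A′ =
the transversal round-transport widening of `TowerRoundB` (res-L1-w45b-stub-4 g10's engine word 340f00d84dbcbbfc, SIG v2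
`L/res-L1-w45b-stub-4/T23Aprime-TransversalTransport.sig.v2.lean` 767f3543c2b2e4ae, brick **(A′-3)** = the special-fibre TRACE of the strict
transform of a retained member, dealt to res-L1-w45b-stub-2 g12 by res-L1-w45b-plan-1's R12′ (iii)). OURS; NOT a statement of H. Hironaka's
2017 manuscript; AI-written, weaker than expert review. No `sorry`; standard axioms; DEF-FREE. `--supports stmt-ResolutionOfSingularities-20148 --as helper`.

WHAT (pure local algebra + the blow-up chart machinery of `Literature/…/BlowupSNC`).
* `span_singleton_eq_maximalIdeal_of_isRadical` — in a Noetherian local ring with PRINCIPAL maximal ideal `𝔪 = (f)`, a nonzero `p ∈ 𝔪`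
  generating a RADICAL ideal generates `𝔪` (Krull intersection). This is the algebra behind stub-4's correction (T2) of the transversality
  rule: it excludes the isolated-crossing case.
* `isRsopPart_of_span_range_eq`, `span_range_eq_of_forall_mem` — bookkeeping for parts of regular systems of parameters.
* **`exists_rsop_transversal_crossing`** — for the blow-up `τ : X₂ → X` of `C` with `HasSNCWith [𝓕] C` and a point `x₂` over
  `x ∈ V(C) ∩ V(𝓕)`, and ANY germ `p ∈ 𝒪_{X,x}` with (h1) `C_x + 𝓕_x + (p) = 𝔪_x`, (h2) `C_x + (p) ≠ 𝔪_x`, (h3) `C_x + (p)` radical,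
  (h4) `p` a nonzerodivisor modulo `C_x`: there are `wE, f' ∈ 𝒪_{X₂,x₂}` with `(C·𝒪_{X₂})_{x₂} = (wE)`, `(St_C 𝓕)_{x₂} = (f')` and
  **`(wE, f', τ♯p)` part of a regular system of parameters of `𝒪_{X₂,x₂}`**. (In (A′-3): `p` = the uniformiser germ; (h1)/(h2) = stub-4's
  (T1)/(T2) pulled back along `jG♯`, (h3) = the reduced trace of `C`, (h4) = `O`-flatness of `V(C)`.)
  PROOF. `exists_chartData` gives a regular system `(x₁..x_r ; w₁..w_a)` of `𝒪_{X,x}` with `C_x = (x)`, `𝓕_x = (w_{m₀})` ((h1)+(h2) forbid an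
  `x`-label); `a ≤ 2` since `𝔪 = (x, w_{m₀}, p)` has `r + 2` generators; `a ≠ 1` by the first lemma in `𝒪_{X,x}/C_x` ((h3), (h4), (h2));
  so `𝔪 = (x, w_{m₀}, w_{m₁}) = (x, w_{m₀}, p)` and `p ≡ unit·w_{m₁} (mod (x, w_{m₀}))`; upstairs `ChartData.exists_rsop` places
  `(x_i, w_{m₀}, w_{m₁})` in a regular system of parameters of `𝒪_{X₂,x₂}`, and the congruence (with `τ♯C_x = (x_i)`) exchanges `w_{m₁}` for `τ♯p`.
[cite: Matsumura1987, Thm. 14.2] [cite: Kollar2007, Def. 3.25]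
-/

set_option linter.dupNamespace false

noncomputable section

open CategoryTheory CategoryTheory.Limits AlgebraicGeometry TopologicalSpace IsLocalRing
open Literature.AlgebraicGeometry.Resolution
open AlgebraicGeometry.Scheme.IdealSheafData

namespace Summit.ResolutionOfSingularities.ResolutionOfSingularities.Cruxes.EquisingularLiftNat.Sections

/-! ## Ring lemmas -/

section Ring

variable {R : Type*} [CommRing R]

/-- **Exclusion of the isolated crossing.** In a Noetherian local ring with principal maximal ideal `𝔪 = (f)`, a nonzero `p ∈ 𝔪` whose
ideal `(p)` is radical generates `𝔪` (otherwise `p ∈ ⋂ₙ (fⁿ) = 0` by Krull's intersection theorem). [cite: Matsumura1987, Thm. 8.10] [folklore] -/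
theorem span_singleton_eq_maximalIdeal_of_isRadical [IsLocalRing R] [IsNoetherianRing R] {f p : R}
    (hf : maximalIdeal R = Ideal.span {f}) (hp : p ∈ maximalIdeal R) (hp0 : p ≠ 0) (hrad : (Ideal.span {p}).IsRadical) :
    Ideal.span {p} = maximalIdeal R := by
  by_contra hne
  -- `p ∈ (f ^ (n+1))` for every `n`
  have key : ∀ n : ℕ, ∃ q : R, p = f ^ (n + 1) * q := by
    intro n
    induction n with
    | zero =>
      have hpf : p ∈ Ideal.span {f} := hf ▸ hp
      obtain ⟨q, hq⟩ := Ideal.mem_span_singleton'.mp hpf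
      exact ⟨q, by rw [zero_add, pow_one, mul_comm, hq]⟩
    | succ n ih =>
      obtain ⟨q, hq⟩ := ih
      by_cases hqu : IsUnit q
      · exfalso
        apply hne
        obtain ⟨b, hb⟩ := hqu.exists_left_inv
        have hfn : f ^ (n + 1) ∈ Ideal.span {p} :=
          Ideal.mem_span_singleton'.mpr ⟨b, by rw [hq, mul_comm, mul_assoc, mul_comm q b, hb, mul_one]⟩
        have hfp : f ∈ Ideal.span {p} := hrad ⟨n + 1, hfn⟩
        refine le_antisymm ((Ideal.span_singleton_le_iff_mem _).mpr hp) ?_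
        rw [hf]
        exact (Ideal.span_singleton_le_iff_mem _).mpr hfp
      · have hqm : q ∈ Ideal.span {f} := hf ▸ (mem_maximalIdeal q).mpr hqu
        obtain ⟨a, ha⟩ := Ideal.mem_span_singleton'.mp hqm
        exact ⟨a, by rw [hq, ← ha]; ring⟩
  apply hp0
  have hmem : p ∈ ⨅ n : ℕ, maximalIdeal R ^ n := by
    refine (Submodule.mem_iInf _).mpr fun n => ?_
    obtain ⟨q, hq⟩ := key n
    rw [hq]
    refine Ideal.mul_mem_right _ _ (Ideal.pow_le_pow_right (Nat.le_succ n) ?_)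
    exact Ideal.pow_mem_pow (hf ▸ Ideal.mem_span_singleton_self f) _
  rw [Ideal.iInf_pow_eq_bot_of_isLocalRing _ (maximalIdeal.isMaximal R).ne_top] at hmem
  exact (Submodule.mem_bot R).mp hmem

/-- Generating the same ideal as a part of a regular system of parameters (same length) is being one. [folklore] -/
theorem isRsopPart_of_span_range_eq [IsLocalRing R] {n : ℕ} {z z' : Fin n → R} (hz : IsRsopPart z)
    (h : Ideal.span (Set.range z') = Ideal.span (Set.range z)) : IsRsopPart z' := by
  obtain ⟨hR, e, y, hdim, hspan⟩ := hz
  refine ⟨hR, e, y, hdim, ?_⟩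
  rw [Ideal.span_union] at hspan ⊢
  rw [h]
  exact hspan

/-- Two families generating each other's members span the same ideal. [folklore] -/
theorem span_range_eq_of_forall_mem {ι ι' : Type*} {z : ι → R} {z' : ι' → R}
    (h1 : ∀ i, z i ∈ Ideal.span (Set.range z')) (h2 : ∀ i, z' i ∈ Ideal.span (Set.range z)) :
    Ideal.span (Set.range z) = Ideal.span (Set.range z') :=
  le_antisymm (Ideal.span_le.mpr (Set.range_subset_iff.mpr h1)) (Ideal.span_le.mpr (Set.range_subset_iff.mpr h2))

/-- In a local ring, `1 - m` is a unit for `m ∈ 𝔪`. [folklore] -/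
theorem isUnit_one_sub_of_mem_maximalIdeal [IsLocalRing R] {m : R} (hm : m ∈ maximalIdeal R) : IsUnit (1 - m) := by
  by_contra hu
  have h1 : (1 : R) - m ∈ maximalIdeal R := (mem_maximalIdeal _).mpr hu
  have : (1 : R) ∈ maximalIdeal R := by
    have := add_mem h1 hm
    rwa [sub_add_cancel] at this
  exact (maximalIdeal.isMaximal R).ne_top ((Ideal.eq_top_iff_one _).mpr this)

end Ring

/-! ## The local package at a transversal crossing point -/

section Local

variable {X X₂ : Scheme.{0}} [IsLocallyNoetherian X] [IsLocallyNoetherian X₂] {τ : X₂ ⟶ X} {C 𝓕 : X.IdealSheafData}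

/-- **The regular system `(exceptional, strict transform, uniformiser)` upstairs at a transversal crossing** — see the module docstring.
[cite: Matsumura1987, Thm. 14.2] [cite: Kollar2007, Def. 3.25] [OURS · L1 W4.5b · T23-A′ (A′-3) local half] toward the B-residues of
stmt-ResolutionOfSingularities-20148; NOT a statement of the manuscript. -/
theorem exists_rsop_transversal_crossing (hτ : IsBlowup τ C) (hE : HasSNCWith [𝓕] C) (x₂ : X₂)
    (hxC : τ x₂ ∈ C.support) (hxF : τ x₂ ∈ 𝓕.support) (p : X.presheaf.stalk (τ x₂))
    (h1 : stalkIdeal C (τ x₂) ⊔ stalkIdeal 𝓕 (τ x₂) ⊔ Ideal.span {p} = maximalIdeal _)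
    (h2 : stalkIdeal C (τ x₂) ⊔ Ideal.span {p} ≠ maximalIdeal _)
    (h3 : (stalkIdeal C (τ x₂) ⊔ Ideal.span {p}).IsRadical)
    (h4 : ∀ a, p * a ∈ stalkIdeal C (τ x₂) → a ∈ stalkIdeal C (τ x₂)) :
    ∃ wE f' : X₂.presheaf.stalk x₂,
      stalkIdeal (C.comap τ) x₂ = Ideal.span {wE} ∧
      stalkIdeal (strictTransformIdeal τ C 𝓕) x₂ = Ideal.span {f'} ∧
      IsRsopPart ![wE, f', (τ.stalkMap x₂).hom p] := by
  classical
  obtain ⟨D, lab, hlabinj, hlab⟩ := exists_chartData hτ hE x₂ hxC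
  haveI hreg : IsRegularLocalRing (X.presheaf.stalk (τ x₂)) := D.hreg
  -- downstairs: the germs of the chart data
  let g0 : Γ(X, D.U) →+* X.presheaf.stalk (τ x₂) := (X.presheaf.germ D.U (τ x₂) D.hxU).hom
  let gx : Fin D.r → X.presheaf.stalk (τ x₂) := fun j => g0 (D.x j)
  let gw : Fin D.a → X.presheaf.stalk (τ x₂) := fun m => g0 (D.w m)
  have hu : Ideal.span (Set.range (Fin.append gx gw)) = maximalIdeal _ := D.hu
  have hCx : stalkIdeal C (τ x₂) = Ideal.span (Set.range gx) := by
    rw [stalkIdeal_eq_map_germ C D.U D.hxU, ← D.hspanC, Ideal.map_span, ← Set.range_comp]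
    rfl
  have hrsop : IsRsopPart (Fin.append gx gw) :=
    isRsopPart_comp_of_rsop D.hd (Fin.append gx gw) hu id Function.injective_id
  have hCm : stalkIdeal C (τ x₂) ≤ maximalIdeal _ := (mem_support_iff_stalkIdeal_le _ _).mp hxC
  have hpm : p ∈ maximalIdeal _ := h1 ▸ Ideal.mem_sup_right (Ideal.mem_span_singleton_self p)
  -- the label of `𝓕`: a `w`, not an `x` ((h1)+(h2))
  have hKmem : 𝓕 ∈ [𝓕] ∧ τ x₂ ∈ 𝓕.support := ⟨List.mem_singleton.mpr rfl, hxF⟩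
  have hlabF := hlab ⟨𝓕, hKmem⟩
  obtain ⟨m₀, hm₀⟩ : ∃ m₀ : Fin D.a, lab ⟨𝓕, hKmem⟩ = Sum.inr m₀ := by
    rcases hl : lab ⟨𝓕, hKmem⟩ with j | m
    · exfalso
      rw [hl, Sum.elim_inl] at hlabF
      apply h2
      have hle : stalkIdeal 𝓕 (τ x₂) ≤ stalkIdeal C (τ x₂) := by
        rw [hlabF, hCx]
        exact Ideal.span_mono (Set.singleton_subset_iff.mpr ⟨j, rfl⟩)
      rw [← h1, sup_eq_left.mpr hle]
    · exact ⟨m, rfl⟩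
  rw [hm₀, Sum.elim_inr] at hlabF
  -- `f := gw m₀` generates `𝓕_x`
  have hFx : stalkIdeal 𝓕 (τ x₂) = Ideal.span {gw m₀} := hlabF
  have hN_le : stalkIdeal C (τ x₂) ⊔ Ideal.span {gw m₀} ≤ maximalIdeal _ := sup_le hCm (hFx ▸ (mem_support_iff_stalkIdeal_le _ _).mp hxF)
  have h1' : stalkIdeal C (τ x₂) ⊔ Ideal.span {gw m₀} ⊔ Ideal.span {p} = maximalIdeal _ := by rw [← hFx]; exact h1
  -- STEP 1: `C_x + (f) ≠ 𝔪` (the isolated-crossing exclusion)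
  have hne : stalkIdeal C (τ x₂) ⊔ Ideal.span {gw m₀} ≠ maximalIdeal _ := by
    intro heq
    -- the quotient `R = 𝒪/C_x`
    have hCprime : (stalkIdeal C (τ x₂)).IsPrime := hCx ▸ hrsop.append_left.isPrime_span_range
    have hCne : stalkIdeal C (τ x₂) ≠ ⊤ := hCprime.ne_top
    haveI : Nontrivial (X.presheaf.stalk (τ x₂) ⧸ stalkIdeal C (τ x₂)) := Ideal.Quotient.nontrivial_iff.mpr hCne
    haveI hRloc : IsLocalRing (X.presheaf.stalk (τ x₂) ⧸ stalkIdeal C (τ x₂)) :=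
      IsLocalRing.of_surjective' (Ideal.Quotient.mk _) Ideal.Quotient.mk_surjective
    set mk := Ideal.Quotient.mk (stalkIdeal C (τ x₂)) with hmk
    have hmk𝔪 : (maximalIdeal _).map mk = maximalIdeal _ := IsLocalRing.map_maximalIdeal_of_surjective mk Ideal.Quotient.mk_surjective
    have hmkC : (stalkIdeal C (τ x₂)).map mk = ⊥ := by rw [hmk, Ideal.map_quotient_self]
    -- `𝔪_R = (f̄)`
    have hf : maximalIdeal _ = Ideal.span {mk (gw m₀)} := by
      rw [← hmk𝔪, ← heq, Ideal.map_sup, hmkC, bot_sup_eq, Ideal.map_span, Set.image_singleton]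
    -- `p̄ ≠ 0`, `p̄ ∈ 𝔪_R`, `(p̄)` radical
    have hp0 : mk p ≠ 0 := by
      intro h0
      rw [hmk, Ideal.Quotient.eq_zero_iff_mem] at h0
      exact hCne ((Ideal.eq_top_iff_one _).mpr (h4 1 (by rw [mul_one]; exact h0)))
    have hpm' : mk p ∈ maximalIdeal _ := hmk𝔪 ▸ Ideal.mem_map_of_mem mk hpm
    have hmap : (stalkIdeal C (τ x₂) ⊔ Ideal.span {p}).map mk = Ideal.span {mk p} := by
      rw [Ideal.map_sup, hmkC, bot_sup_eq, Ideal.map_span, Set.image_singleton]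
    have hrad : (Ideal.span {mk p}).IsRadical := by
      have hker : RingHom.ker mk ≤ stalkIdeal C (τ x₂) ⊔ Ideal.span {p} := by rw [hmk, Ideal.mk_ker]; exact le_sup_left
      have h := Ideal.map_radical_of_surjective Ideal.Quotient.mk_surjective hker
      rw [h3.radical, hmap] at h
      intro x hx
      rw [← h] at hx
      exact hx
    have hspan := span_singleton_eq_maximalIdeal_of_isRadical hf hpm' hp0 hrad
    -- pull back: `C_x + (p) = 𝔪`
    apply h2
    have hcomap : (Ideal.span {mk p}).comap mk = stalkIdeal C (τ x₂) ⊔ Ideal.span {p} := by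
      rw [← hmap, Ideal.comap_map_of_surjective _ Ideal.Quotient.mk_surjective, ← RingHom.ker_eq_comap_bot, Ideal.mk_ker,
        sup_assoc, sup_comm (Ideal.span {p}) (stalkIdeal C (τ x₂)), ← sup_assoc, sup_idem]
    rw [← hcomap, hspan]
    exact IsLocalRing.eq_maximalIdeal (Ideal.comap_isMaximal_of_surjective mk Ideal.Quotient.mk_surjective)
  -- STEP 2: another `w`-coordinate `w_{m₁} ∉ C_x + (f)`
  obtain ⟨m₁, hm₁⟩ : ∃ m₁ : Fin D.a, gw m₁ ∉ stalkIdeal C (τ x₂) ⊔ Ideal.span {gw m₀} := by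
    by_contra hall
    push Not at hall
    apply hne
    refine le_antisymm hN_le ?_
    rw [← hu, Ideal.span_le, Set.range_subset_iff]
    intro i
    induction i using Fin.addCases with
    | left j =>
      rw [Fin.append_left]
      exact Ideal.mem_sup_left (hCx ▸ Ideal.subset_span ⟨j, rfl⟩)
    | right m =>
      rw [Fin.append_right]
      exact hall m
  have hm₁₀ : m₁ ≠ m₀ := by
    rintro rfl
    exact hm₁ (Ideal.mem_sup_right (Ideal.mem_span_singleton_self _))
  -- STEP 3: `a ≤ 2`, hence every `w`-index is `m₀` or `m₁`, hence `𝔪 = C_x + (f) + (w_{m₁})`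
  have ha2 : D.a ≤ 2 := by
    have hgen : Ideal.span (↑(Finset.univ.image gx ∪ {gw m₀, p}) : Set (X.presheaf.stalk (τ x₂))) = maximalIdeal _ := by
      rw [Finset.coe_union, Finset.coe_image, Finset.coe_univ, Set.image_univ, Finset.coe_insert, Finset.coe_singleton,
        Ideal.span_union, Ideal.span_insert, ← hCx, ← sup_assoc]
      exact h1'
    have hle : (maximalIdeal (X.presheaf.stalk (τ x₂))).spanFinrank ≤ (Finset.univ.image gx ∪ {gw m₀, p}).card := by
      rw [← hgen, ← Set.ncard_coe_finset]
      exact Submodule.spanFinrank_span_le_ncard_of_finite (Finset.finite_toSet _)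
    have hcard : (Finset.univ.image gx ∪ {gw m₀, p}).card ≤ D.r + 2 :=
      (Finset.card_union_le _ _).trans (add_le_add ((Finset.card_image_le).trans (by simp)) Finset.card_le_two)
    have := D.hd ▸ hle.trans hcard
    omega
  have hidx : ∀ m : Fin D.a, m = m₀ ∨ m = m₁ := by
    intro m
    by_contra hm
    push Not at hm
    have h3le : ({m₀, m₁, m} : Finset (Fin D.a)).card ≤ 2 := (Finset.card_le_univ _).trans (by simpa using ha2)
    have h3eq : ({m₀, m₁, m} : Finset (Fin D.a)).card = 3 := by
      rw [Finset.card_insert_of_notMem, Finset.card_pair hm.2.symm]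
      simp only [Finset.mem_insert, Finset.mem_singleton, not_or]
      exact ⟨hm₁₀.symm, hm.1.symm⟩
    omega
  have h𝔪w : stalkIdeal C (τ x₂) ⊔ Ideal.span {gw m₀} ⊔ Ideal.span {gw m₁} = maximalIdeal _ := by
    refine le_antisymm (sup_le hN_le ((Ideal.span_singleton_le_iff_mem _).mpr (hu ▸ Ideal.subset_span ⟨Fin.natAdd D.r m₁, by simp [gw]⟩))) ?_
    rw [← hu, Ideal.span_le, Set.range_subset_iff]
    intro i
    induction i using Fin.addCases with
    | left j =>
      rw [Fin.append_left]
      exact Ideal.mem_sup_left (Ideal.mem_sup_left (hCx ▸ Ideal.subset_span ⟨j, rfl⟩))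
    | right m =>
      rw [Fin.append_right]
      rcases hidx m with rfl | rfl
      · exact Ideal.mem_sup_left (Ideal.mem_sup_right (Ideal.mem_span_singleton_self _))
      · exact Ideal.mem_sup_right (Ideal.mem_span_singleton_self _)
  -- STEP 4: `p ≡ s·w_{m₁} (mod C_x + (f))` with `s` a unit
  obtain ⟨n', hn', s, hps⟩ : ∃ n' ∈ stalkIdeal C (τ x₂) ⊔ Ideal.span {gw m₀}, ∃ s : X.presheaf.stalk (τ x₂), p = n' + s * gw m₁ := by
    have hp𝔪 : p ∈ stalkIdeal C (τ x₂) ⊔ Ideal.span {gw m₀} ⊔ Ideal.span {gw m₁} := h𝔪w ▸ hpm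
    obtain ⟨n', hn', z, hz, hsum⟩ := Submodule.mem_sup.mp hp𝔪
    obtain ⟨s, rfl⟩ := Ideal.mem_span_singleton'.mp hz
    exact ⟨n', hn', s, hsum.symm⟩
  obtain ⟨n, hn, t, hwt⟩ : ∃ n ∈ stalkIdeal C (τ x₂) ⊔ Ideal.span {gw m₀}, ∃ t : X.presheaf.stalk (τ x₂), gw m₁ = n + t * p := by
    have hw𝔪 : gw m₁ ∈ stalkIdeal C (τ x₂) ⊔ Ideal.span {gw m₀} ⊔ Ideal.span {p} :=
      h1' ▸ (hu ▸ Ideal.subset_span ⟨Fin.natAdd D.r m₁, by simp [gw]⟩)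
    obtain ⟨n, hn, z, hz, hsum⟩ := Submodule.mem_sup.mp hw𝔪
    obtain ⟨t, rfl⟩ := Ideal.mem_span_singleton'.mp hz
    exact ⟨n, hn, t, hsum.symm⟩
  have hs : IsUnit s := by
    by_contra hsu
    have hsm : s ∈ maximalIdeal _ := (mem_maximalIdeal s).mpr hsu
    apply hne
    -- `p (1 - s t) ∈ C_x + (f)`, so `p ∈ C_x + (f)` and `𝔪 = C_x + (f) + (p) = C_x + (f)`
    have hpN : p ∈ stalkIdeal C (τ x₂) ⊔ Ideal.span {gw m₀} := by
      have hunit := isUnit_one_sub_of_mem_maximalIdeal (Ideal.mul_mem_right t _ hsm)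
      have hmem : p * (1 - s * t) ∈ stalkIdeal C (τ x₂) ⊔ Ideal.span {gw m₀} := by
        have : p * (1 - s * t) = n' + s * n := by
          have e1 : p = n' + s * (n + t * p) := by rw [← hwt]; exact hps
          linear_combination e1
        rw [this]
        exact add_mem hn' (Ideal.mul_mem_left _ s hn)
      obtain ⟨u, hu'⟩ := hunit
      have := Ideal.mul_mem_right (↑u⁻¹ : X.presheaf.stalk (τ x₂)) _ hmem
      rwa [← hu', mul_assoc, Units.mul_inv, mul_one] at this
    rw [← h1', sup_eq_left.mpr ((Ideal.span_singleton_le_iff_mem _).mpr hpN)]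
  -- UPSTAIRS: the labelled regular system of parameters of `𝒪_{X₂,x₂}`
  obtain ⟨hBreg, d, v, hd', hv, labU, hlabUinj, hvE, hvW, -⟩ := D.exists_rsop hxC
  haveI := hBreg
  set ψ := (τ.stalkMap x₂).hom with hψ
  have hto : ∀ sec : Γ(X, D.U), D.toStalk (reesChartBase (D.x D.i) (Ideal.mem_span_range_self (f := D.x) (x := D.i)) sec) = ψ (g0 sec) :=
    fun sec => by rw [D.toStalk_eq, D.algebraMap_reesChartBase]
  -- the three labelled members
  set wE := D.toStalk (reesChartBase (D.x D.i) (Ideal.mem_span_range_self (f := D.x) (x := D.i)) (D.x D.i)) with hwE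
  have hExc : stalkIdeal (C.comap τ) x₂ = Ideal.span {wE} := D.stalkIdeal_exceptional hxC
  have hSt : stalkIdeal (strictTransformIdeal τ C 𝓕) x₂ = Ideal.span {ψ (gw m₀)} := by
    rw [← hto]; exact D.stalkIdeal_strictTransform_w hxC 𝓕 m₀ hFx
  let ι₃ : Fin 3 → Option (Fin D.a ⊕ D.GoodGen) := ![none, some (Sum.inl m₀), some (Sum.inl m₁)]
  have hι₃ : Function.Injective ι₃ := by
    intro a b hab
    fin_cases a <;> fin_cases b <;> simp [ι₃] at hab ⊢ <;> first | exact absurd hab hm₁₀.symm | exact absurd hab hm₁₀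
  have hz : IsRsopPart (v ∘ (labU ∘ ι₃)) := isRsopPart_comp_of_rsop hd' v hv (labU ∘ ι₃) (hlabUinj.comp hι₃)
  have hzeq : v ∘ (labU ∘ ι₃) = ![wE, ψ (gw m₀), ψ (gw m₁)] := by
    funext i
    fin_cases i
    · simp [ι₃, hvE, hwE]
    · simp [ι₃, hvW, hto, gw]
    · simp [ι₃, hvW, hto, gw]
  rw [hzeq] at hz
  -- the exchange `w_{m₁} ↦ τ♯p`: `τ♯p = τ♯n' + τ♯s · τ♯w_{m₁}` with `τ♯n' ∈ (wE) + (τ♯f)`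
  have hn'up : ψ n' ∈ Ideal.span {wE} ⊔ Ideal.span {ψ (gw m₀)} := by
    obtain ⟨c, hc, z, hz', rfl⟩ := Submodule.mem_sup.mp hn'
    obtain ⟨β, rfl⟩ := Ideal.mem_span_singleton'.mp hz'
    rw [map_add, map_mul]
    refine add_mem (Ideal.mem_sup_left ?_) (Ideal.mem_sup_right (Ideal.mul_mem_left _ _ (Ideal.mem_span_singleton_self _)))
    rw [← hExc, stalkIdeal_comap_eq_map_stalkMap]
    exact Ideal.mem_map_of_mem _ hc
  have hspan_eq : Ideal.span (Set.range ![wE, ψ (gw m₀), ψ p]) = Ideal.span (Set.range ![wE, ψ (gw m₀), ψ (gw m₁)]) := by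
    have hsub12 : Ideal.span {wE} ⊔ Ideal.span {ψ (gw m₀)} ≤ Ideal.span (Set.range ![wE, ψ (gw m₀), ψ (gw m₁)]) :=
      sup_le ((Ideal.span_singleton_le_iff_mem _).mpr (Ideal.subset_span ⟨0, rfl⟩))
        ((Ideal.span_singleton_le_iff_mem _).mpr (Ideal.subset_span ⟨1, rfl⟩))
    have hsub12' : Ideal.span {wE} ⊔ Ideal.span {ψ (gw m₀)} ≤ Ideal.span (Set.range ![wE, ψ (gw m₀), ψ p]) :=
      sup_le ((Ideal.span_singleton_le_iff_mem _).mpr (Ideal.subset_span ⟨0, rfl⟩))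
        ((Ideal.span_singleton_le_iff_mem _).mpr (Ideal.subset_span ⟨1, rfl⟩))
    obtain ⟨u, hu'⟩ := hs.map ψ
    apply span_range_eq_of_forall_mem
    · intro i
      fin_cases i
      · exact Ideal.subset_span ⟨0, rfl⟩
      · exact Ideal.subset_span ⟨1, rfl⟩
      · change ψ p ∈ _
        rw [hps, map_add, map_mul]
        exact add_mem (hsub12 hn'up) (Ideal.mul_mem_left _ _ (Ideal.subset_span ⟨2, rfl⟩))
    · intro i
      fin_cases i
      · exact Ideal.subset_span ⟨0, rfl⟩
      · exact Ideal.subset_span ⟨1, rfl⟩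
      · change ψ (gw m₁) ∈ _
        have hw₁ : ψ (gw m₁) = ↑u⁻¹ * (ψ p - ψ n') := by
          rw [hps, map_add, map_mul, ← hu', add_sub_cancel_left, ← mul_assoc, Units.inv_mul, one_mul]
        rw [hw₁]
        exact Ideal.mul_mem_left _ _ (sub_mem (Ideal.subset_span ⟨2, rfl⟩) (hsub12' hn'up))
  refine ⟨wE, ψ (gw m₀), hExc, hSt, isRsopPart_of_span_range_eq hz hspan_eq⟩

end Local

end Summit.ResolutionOfSingularities.ResolutionOfSingularities.Cruxes.EquisingularLiftNat.Sections

end
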